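import Mathlib
import Summits.NavierStokesRegularity.NavierStokesRegularity.Theorems.EulerZoomLiouvillePowerGaugeEulerLiouvilleLagrangianTrace
import Summits.NavierStokesRegularity.NavierStokesRegularity.Theorems.EulerZoomLiouvillePowerGaugeEulerLiouvilleRayVorticityLaw
import HarnessLib

/-!
# Crux `EulerZoomLiouville.PowerGaugeEulerLiouville` (stmt-NavierStokesRegularity-19832): THE TRAJECTORY-WISE CEILING — plate t59-TC of nsreg-p2 ROUND-54 «THE TRACE» (addendum v1.1)

Width/portrait piece for THE ONE STATEMENT `stub_selfSimilarC2Needle` (LEAD skeleton `Cruxes/PowerGaugeEulerLiouville/Lines/birth.lean`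
v112, ns-typeII-p2 g16), `--supports stmt-NavierStokesRegularity-19832 --as helper`.  Texts = nsreg-p2 g44's `r54/Sketch54add.lean`
(sha16 6df3b51988c76f52, namespace `NsregP2.R54.Trace`) `TrajectoryCeilingLaw ρ V` and `r54/Sketch54.lean` (f78682d2f4ee3f27)
`ae_vorticityLimit_of_traceLaw`, VERBATIM with the interface structure `IsForwardSimilarityFlow ρ V Φ` destructured into its two fields
(`∀ y, Φ 0 y = y` and the forward ODE `∂_s Φ_s y = γΦ_s y + V(Φ_s y)`, `s ≥ 0`) — this file stays definition-free.

Setting: a `C²` self-similar Euler profile `(V, P)` with `γ = 1/(2+ρ)`, centre `0`, in the budget class (`E_w = ∫‖DV‖²‖y‖^{ρ−1} < ∞`,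
A-gauge `∫_{B_R}‖V‖² ≤ A R^{1−2ρ}`), `Ω = curl V`, and a GLOBAL forward similarity flow `Φ` of `W = γy + V`.

CONTENTS (all PROVED, std axioms), both now UNCONDITIONAL for `−½ < ρ ≤ 1` because the two laws of record are theorems of the tree —
THE LAGRANGIAN TRACE LAW `Trace.lagrangianTraceLaw` (t59-LT, `…LagrangianTrace`) and THE RAY LAW `RayVorticity.rayVorticityLaw` (t58,
`…RayVorticityLaw`, ns-ezl-w3 g8):
* `ae_vorticityLimit` — along `Φ`, a.e. label `y` carries a LIMIT `ω_∞(y) = lim_{s→∞} e^{s}Ω(Φ_s y)` of its renormalised (= physical)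
  vorticity, NON-ZERO wherever `Ω(y) ≠ 0` (= Sketch54 `ae_vorticityLimit_of_traceLaw`, discharged);
* `trajectoryCeilingLaw (hρ : -1/2 < ρ) (hρ1 : ρ ≤ 1) V` — THE TRAJECTORY-WISE CEILING: a.e. label has `e^{s}Ω(Φ_s y)` BOUNDED on the
  whole forward ray (= Sketch54add `TrajectoryCeilingLaw ρ V`, proof = `trajectoryCeilingLaw_of_traceLaw`: integrable strain ⇒ the ray law
  makes `e^{s}Ω(Φ_s y)` converge ⇒ a continuous convergent function is bounded, `exists_bound_of_continuousOn_of_tendsto'`).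
By-name check: `example {ρ} (hρ : -1/2 < ρ) (hρ1 : ρ ≤ 1) (V) : NsregP2.R54.Trace.TrajectoryCeilingLaw ρ V :=
fun P hP hE hA Φ hΦ => Trace.trajectoryCeilingLaw hρ hρ1 V P hP hE hA Φ hΦ.init hΦ.hasDerivAt`.

HONEST FRAMING: portrait instruments about HYPOTHETICAL profiles (in physical variables: the vorticity of almost every particle stays
bounded up to the blow-up time although `‖ω(τ)‖_∞ → ∞`); nothing here bears on the crux E (19832, OPEN) or on NS regularity.
[nsreg-p2 R54 §C t59-TC; cite: ConstantinIgnatovaVicol2026Putative, §3.4.1 eq. (3.4), (3.21)–(3.24)]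
-/

noncomputable section

set_option linter.dupNamespace false

open Filter Topology MeasureTheory Set Metric Function
open scoped RealInnerProductSpace ENNReal NNReal

namespace Summit.NavierStokesRegularity.NavierStokesRegularity.Theorems.PowerGaugeEulerLiouville.Trace

open Literature.Analysis Literature.Analysis.FluidPDE
open Summit.NavierStokesRegularity.NavierStokesRegularity.Theorems.PowerGaugeEulerLiouville

/-- A function into `ℝ³` continuous on `[0, ∞)` with a limit at `+∞` is bounded on `[0, ∞)` (Sketch54add
`exists_bound_of_continuousOn_of_tendsto`). [folklore] -/
theorem exists_bound_of_continuousOn_of_tendsto' {f : ℝ → EuclideanSpace ℝ (Fin 3)} {l : EuclideanSpace ℝ (Fin 3)}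
    (hc : ContinuousOn f (Ici 0)) (hl : Tendsto f atTop (𝓝 l)) : ∃ B : ℝ, ∀ s : ℝ, 0 ≤ s → ‖f s‖ ≤ B := by
  -- beyond some `S₀` the function is within distance `1` of its limit
  have h1 : ∀ᶠ s in atTop, dist (f s) l < 1 := (Metric.tendsto_nhds.mp hl) 1 one_pos
  obtain ⟨S₀, hS₀⟩ := Filter.eventually_atTop.mp h1
  -- on the compact interval `[0, max S₀ 0]` it is bounded by continuity
  have hK : IsCompact (Icc (0 : ℝ) (max S₀ 0)) := isCompact_Icc
  have hcK : ContinuousOn f (Icc (0 : ℝ) (max S₀ 0)) := hc.mono (fun s hs => hs.1)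
  obtain ⟨B₁, hB₁⟩ := hK.exists_bound_of_continuousOn hcK
  refine ⟨max B₁ (‖l‖ + 1), fun s hs => ?_⟩
  by_cases hsS : s ≤ max S₀ 0
  · exact (hB₁ s ⟨hs, hsS⟩).trans (le_max_left _ _)
  · have hs' : S₀ ≤ s := le_trans (le_max_left _ _) (le_of_lt (not_le.mp hsS))
    have hd : dist (f s) l < 1 := hS₀ s hs'
    have : ‖f s‖ ≤ ‖l‖ + 1 := by
      have h := norm_le_norm_add_norm_sub' (f s) l
      rw [← dist_eq_norm] at h
      linarith
    exact this.trans (le_max_right _ _)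

/-- **THE LIMITING VORTICITY OF ALMOST EVERY PARTICLE — UNCONDITIONAL for `−½ < ρ ≤ 1`** (= Sketch54 `ae_vorticityLimit_of_traceLaw` with
its two law hypotheses discharged by the tree's `Trace.lagrangianTraceLaw` and `RayVorticity.rayVorticityLaw`).  Along a global forward
similarity flow `Φ` of a budget-class profile, a.e. label `y` carries a LIMIT `ω_∞(y) = lim_{s→∞} e^{s}Ω(Φ_s y)` of its renormalised
(= physical) vorticity, NON-ZERO wherever `Ω(y) ≠ 0`: the self-similar collapse is Lagrangian-invisible to almost every particle.
[nsreg-p2 R54 §C; cite: ConstantinIgnatovaVicol2026Putative, §3.4.1 eq. (3.4), (3.23)–(3.24)] -/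
theorem ae_vorticityLimit {ρ : ℝ} (hρ : -1 / 2 < ρ) (hρ1 : ρ ≤ 1) (V : EuclideanSpace ℝ (Fin 3) → EuclideanSpace ℝ (Fin 3))
    {P : EuclideanSpace ℝ (Fin 3) → ℝ} (hP : IsSelfSimilarEulerProfile (1 / (2 + ρ)) 0 V P)
    (hE : (∫⁻ y, ‖fderiv ℝ V y‖ₑ ^ 2 * ENNReal.ofReal (‖y‖ ^ (ρ - 1))) ≠ ⊤)
    (hA : ∃ A : ℝ, ∀ R : ℝ, 1 ≤ R → ∫ y in ball (0 : EuclideanSpace ℝ (Fin 3)) R, ‖V y‖ ^ 2 ≤ A * R ^ (1 - 2 * ρ))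
    {Φ : ℝ → EuclideanSpace ℝ (Fin 3) → EuclideanSpace ℝ (Fin 3)} (hΦ0 : ∀ y, Φ 0 y = y)
    (hΦ : ∀ y (s : ℝ), 0 ≤ s → HasDerivAt (fun σ => Φ σ y) ((1 / (2 + ρ)) • Φ s y + V (Φ s y)) s) :
    ∀ᵐ y : EuclideanSpace ℝ (Fin 3), ∃ ωinf : EuclideanSpace ℝ (Fin 3),
      Tendsto (fun s => Real.exp s • curl V (Φ s y)) atTop (𝓝 ωinf) ∧ (curl V y ≠ 0 → ωinf ≠ 0) := by
  filter_upwards [lagrangianTraceLaw hρ hρ1 V P hP hE hA Φ hΦ0 hΦ] with y hy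
  obtain ⟨ωinf, hlim, hne⟩ := RayVorticity.rayVorticityLaw ρ V P hP (fun s => Φ s y) (fun s hs => hΦ y s hs) hy
  refine ⟨ωinf, hlim, ?_⟩
  simpa only [hΦ0 y] using hne

/-- **THE TRAJECTORY-WISE CEILING — PROVED, UNCONDITIONAL for `−½ < ρ ≤ 1`** (text = `NsregP2.R54.Trace.TrajectoryCeilingLaw ρ V` of
`r54/Sketch54add.lean` 6df3b51988c76f52 with `IsForwardSimilarityFlow` destructured; proof = Sketch54add
`trajectoryCeilingLaw_of_traceLaw` over the tree's `Trace.lagrangianTraceLaw` (t59-LT) and `RayVorticity.rayVorticityLaw` (t58)).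
Along a global forward similarity flow `Φ` of a budget-class profile, almost every label `y` has its renormalised (= physical) vorticity
`e^{s}Ω(Φ_s y)` BOUNDED on the whole forward ray `s ≥ 0`: in physical variables `sup_{τ ∈ [−1, 0)} |ω(τ, x(τ))| < ∞` for a.e. particle,
although `‖ω(τ)‖_∞ = (−τ)^{−1}‖Ω‖_∞ → ∞` — strictly MORE than the Eulerian `VorticityCeiling.vorticityCeilingLaw`.
Mechanism: a.e. label has integrable strain (LT); the ray law makes `e^{s}Ω(Φ_s y)` converge; a continuous convergent function is bounded.
[nsreg-p2 R54 §C t59-TC; cite: ConstantinIgnatovaVicol2026Putative, §3.4.1 eq. (3.4), (3.21)–(3.24)] -/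
theorem trajectoryCeilingLaw {ρ : ℝ} (hρ : -1 / 2 < ρ) (hρ1 : ρ ≤ 1) (V : EuclideanSpace ℝ (Fin 3) → EuclideanSpace ℝ (Fin 3)) :
    ∀ P : EuclideanSpace ℝ (Fin 3) → ℝ, IsSelfSimilarEulerProfile (1 / (2 + ρ)) 0 V P →
    (∫⁻ y, ‖fderiv ℝ V y‖ₑ ^ 2 * ENNReal.ofReal (‖y‖ ^ (ρ - 1))) ≠ ⊤ →
    (∃ A : ℝ, ∀ R : ℝ, 1 ≤ R → ∫ y in ball (0 : EuclideanSpace ℝ (Fin 3)) R, ‖V y‖ ^ 2 ≤ A * R ^ (1 - 2 * ρ)) →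
    ∀ Φ : ℝ → EuclideanSpace ℝ (Fin 3) → EuclideanSpace ℝ (Fin 3), (∀ y, Φ 0 y = y) →
      (∀ y (s : ℝ), 0 ≤ s → HasDerivAt (fun σ => Φ σ y) ((1 / (2 + ρ)) • Φ s y + V (Φ s y)) s) →
      ∀ᵐ y : EuclideanSpace ℝ (Fin 3), ∃ B : ℝ, ∀ s : ℝ, 0 ≤ s → ‖Real.exp s • curl V (Φ s y)‖ ≤ B := by
  intro P hP hE hA Φ hΦ0 hΦ
  have hV2 : ContDiff ℝ 2 V := hP.contDiff_velocity
  have hΩc : Continuous (curl V) := (differentiable_curl_of_contDiff hV2).continuous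
  filter_upwards [lagrangianTraceLaw hρ hρ1 V P hP hE hA Φ hΦ0 hΦ] with y hy
  obtain ⟨ωinf, hlim, -⟩ := RayVorticity.rayVorticityLaw ρ V P hP (fun s => Φ s y) (fun s hs => hΦ y s hs) hy
  have hΦc : ContinuousOn (fun s => Φ s y) (Ici 0) :=
    fun s hs => (hΦ y s hs).continuousAt.continuousWithinAt
  have hc : ContinuousOn (fun s => Real.exp s • curl V (Φ s y)) (Ici 0) :=
    Real.continuous_exp.continuousOn.smul (hΩc.comp_continuousOn hΦc)
  exact exists_bound_of_continuousOn_of_tendsto' hc hlim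

end Summit.NavierStokesRegularity.NavierStokesRegularity.Theorems.PowerGaugeEulerLiouville.Trace

end
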